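import Literature.Algebra.Polynomial.PadicRootMultiplicityRigidity
import Literature.NumberTheory.LFunctions.PadicRootsOfUnitySeparation
import HarnessLib

/-!
# The resultants `Res(P, X^r - 1)` of a candidate Weil polynomial: `ℓ`-adic and `p`-adic bookkeeping

Topic `NumberTheory/LFunctions`; **proof file**, theorems only (D-0014/D-0026).  This is the
non-archimedean half of `WeilPolynomialFromPointCounts` (the determination of the characteristic
polynomial of Frobenius from the point counts `#A(𝔽_{q^r})` without Mumford §19 Thm. 2).

Setting: a prime `p`, a monic `P ∈ ℤ[X]` of degree `N`, and `R_r = Res(P, X^r - 1) ∈ ℤ`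
(`Polynomial.resultant P (X^r - 1) N r`).  Write `kerNorm_ℓ(Q, F) = ∏_{Q(b)=0} |F(b)|_ℓ⁻¹`
(`Literature.Algebra.Polynomial.RootRigidity.kerNorm`).

* `algebraMap_resultant_X_pow_sub_one` — in an algebraically closed field, `R_r ↦ ∏_{P(β)=0} (β^r - 1)`
  (Mathlib `resultant_eq_prod_roots_sub`);
* `kerNorm_map_X_pow_sub_one_eq` — `kerNorm_ℓ(P, X^r - 1) = |R_r|_ℓ⁻¹`;
* `kerNorm_le_kerNorm_of_roots_le` — `kerNorm_p(Q_p, F) ≤ kerNorm_p(P, F)` when the roots of `Q_p` form a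
  sub-multiset of those of `P` (all `F(β) ≠ 0`; the extra factors are `≥ 1` by integrality);
* `exists_pow_padicValInt_resultant_le` — **`p^{v_p(R_r)} ≤ C · r^N`** (`R_r ≠ 0` for all `r`): the roots of
  `P` are no roots of unity, so `∏_{ζ^r=1} |β - ζ|_p ≥ c_β |r|_p ≥ c_β / r` (`PadicRootsOfUnitySeparation`);
* `natAbs_resultant_eq_mul_div` — if `ℓ^{v_ℓ(h_r)} = kerNorm_ℓ(P, X^r - 1)` for all primes `ℓ ≠ p` and
  `p^{v_p(h_r)} = kerNorm_p(Q_p, X^r - 1)`, then **`|R_r| = h_r · kerNorm_p(P, X^r-1) / kerNorm_p(Q_p, X^r-1)`**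
  with the last quotient a power `p^{a_r}`, `a_r ≥ 0` (unique factorization);
* `kerNorm_eq_kerNorm_of_bounded` — **the tower argument**: if moreover that quotient is bounded in `r`,
  it is `1` for every `r`: a `p`-adic unit root `β₀` of `P` not accounted for by `Q_p` has
  `|β₀^d - 1|_p < 1` for some `d ≥ 1` (pigeonhole in `ℤ_p[X]/(P, p)`, as in
  `PadicRootMultiplicityRigidity`) and then `|β₀^{d p^t} - 1|_p ≤ θ^t |β₀^d - 1|_p → 0`
  (`|(1+y)^p - 1| ≤ |y| max(|p|, |y|)`), making the quotient unbounded; so all those roots have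
  `|β|_p < 1`, whence `|β^r - 1|_p = 1`;
* `natAbs_resultant_eq_of_bounded` — consequently `|R_r| = h_r` for all `r ≥ 1`.

## References

This route is the tree's own (see `Motives/AbelianVarietyFrobeniusCharpolyRigidity`); the statement it
serves is Weil's determination of the characteristic polynomial of Frobenius (Mumford, *Abelian Varieties*,
§19 Thm. 4, §21; Milne 1986, Thm. 19.1). [folklore]

## Design

Mathlib (pin, used): `Polynomial.resultant`, `resultant_map_map`, `resultant_eq_prod_roots_sub`,
`prod_multiset_X_sub_C_of_monic_of_roots_card_eq`, `Multiset.cons_product`, `Nat.eq_of_factorization_eq`,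
`Nat.Prime.factorization_pow`, `pow_unbounded_of_one_lt`, `Fintype.exists_ne_map_eq_of_card_lt`.
In the tree (used): `RootRigidity.kerNorm`, `redMod`, `exists_modByMonic_eq_of_redMod_eq`,
`norm_aeval_le_of_modByMonic_eq`, `norm_aeval_le_one`, `aeval_eq_eval_map_map`,
`PadicInt.norm_le_one_of_mem_roots_map`, `TateModule.norm_intCast_padic_eq`, `PadicRootsOfUnity.*`.
-/

noncomputable section

open Polynomial
open scoped Classical

namespace Literature.NumberTheory.LFunctions

namespace FrobeniusRigidity

open Literature.Algebra.Polynomial Literature.Algebra.Polynomial.RootRigidity PadicRootsOfUnity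

/-! ### `Res(P, X^r - 1) = ∏_{P(β) = 0} (β^r - 1)` over an algebraically closed field -/

section Resultant

variable {L : Type*} [Field L] [IsAlgClosed L]

omit [IsAlgClosed L] in
/-- `∏_{(a,b) ∈ s × t} (a - b) = ∏_{a ∈ s} ∏_{b ∈ t} (a - b)` for multisets. [folklore] -/
theorem prod_map_product_sub (s t : Multiset L) :
    ((s ×ˢ t).map fun ij : L × L => ij.1 - ij.2).prod = (s.map fun a => (t.map fun b => a - b).prod).prod := by
  induction s using Multiset.induction_on with
  | empty => rw [Multiset.zero_product, Multiset.map_zero, Multiset.map_zero, Multiset.prod_zero]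
  | cons a s ih =>
    rw [Multiset.cons_product, Multiset.map_add, Multiset.prod_add, ih, Multiset.map_cons, Multiset.prod_cons,
      Multiset.map_map]
    rfl

/-- `∏_{ζ^r = 1} (a - ζ) = a^r - 1` (product over the roots of `X^r - 1`, with multiplicity). [folklore] -/
theorem prod_roots_X_pow_sub_one_sub {r : ℕ} (hr : 0 < r) (a : L) :
    ((X ^ r - 1 : L[X]).roots.map fun b => a - b).prod = a ^ r - 1 := by
  have hmon : (X ^ r - 1 : L[X]).Monic := by simpa only [map_one] using monic_X_pow_sub_C (1 : L) hr.ne'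
  have hcard : Multiset.card (X ^ r - 1 : L[X]).roots = (X ^ r - 1 : L[X]).natDegree :=
    ((IsAlgClosed.splits _).natDegree_eq_card_roots).symm
  have h := congrArg (eval a) (prod_multiset_X_sub_C_of_monic_of_roots_card_eq hmon hcard)
  rw [eval_multiset_prod, Multiset.map_map, eval_sub, eval_pow, eval_X, eval_one] at h
  rw [← h]
  exact congrArg _ (Multiset.map_congr rfl fun b _ => by simp)

/-- **`Res(P, X^r - 1) = ∏_{P(β)=0} (β^r - 1)`** in an algebraically closed field `L`, for `P ∈ ℤ[X]` monic of
degree `N` and `r ≥ 1` (the resultant taken with the size parameters `N`, `r`). [folklore] -/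
theorem algebraMap_resultant_X_pow_sub_one {P : ℤ[X]} (hP : P.Monic) {N : ℕ} (hPN : P.natDegree = N)
    {r : ℕ} (hr : 0 < r) :
    algebraMap ℤ L (Polynomial.resultant P (X ^ r - 1) N r) =
      ((P.map (algebraMap ℤ L)).roots.map fun b => b ^ r - 1).prod := by
  have h1 : algebraMap ℤ L (resultant P (X ^ r - 1) N r) =
      resultant (P.map (algebraMap ℤ L)) ((X ^ r - 1 : ℤ[X]).map (algebraMap ℤ L)) N r :=
    (resultant_map_map P (X ^ r - 1) N r (algebraMap ℤ L)).symm
  have hXmap : ((X ^ r - 1 : ℤ[X]).map (algebraMap ℤ L)) = X ^ r - 1 := by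
    rw [Polynomial.map_sub, Polynomial.map_pow, map_X, Polynomial.map_one]
  rw [h1, hXmap]
  have hPm : (P.map (algebraMap ℤ L)).Monic := hP.map _
  have hXm : (X ^ r - 1 : L[X]).Monic := by simpa only [map_one] using monic_X_pow_sub_C (1 : L) hr.ne'
  have hdegP : (P.map (algebraMap ℤ L)).natDegree = N := by rw [hP.natDegree_map, hPN]
  have hdegX : (X ^ r - 1 : L[X]).natDegree = r := by
    simpa only [map_one] using natDegree_X_pow_sub_C (n := r) (r := (1 : L))
  have h2 := resultant_eq_prod_roots_sub (P.map (algebraMap ℤ L)) (X ^ r - 1) hPm hXm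
    (IsAlgClosed.splits _) (IsAlgClosed.splits _)
  rw [hdegP, hdegX] at h2
  rw [h2, prod_map_product_sub]
  exact congrArg _ (Multiset.map_congr rfl fun b _ => prod_roots_X_pow_sub_one_sub hr b)

/-- If `Res(P, X^r - 1) ≠ 0` then no root of `P` (in an algebraically closed field of characteristic `0`)
is an `r`-th root of unity. [folklore] -/
theorem pow_ne_one_of_resultant_ne_zero [CharZero L] {P : ℤ[X]} (hP : P.Monic) {N : ℕ} (hPN : P.natDegree = N)
    {r : ℕ} (hr : 0 < r) (hR : Polynomial.resultant P (X ^ r - 1) N r ≠ 0) {b : L}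
    (hb : b ∈ (P.map (algebraMap ℤ L)).roots) : b ^ r ≠ 1 := by
  intro h1
  apply hR
  have h := algebraMap_resultant_X_pow_sub_one (L := L) hP hPN hr
  have h0 : ((P.map (algebraMap ℤ L)).roots.map fun b => b ^ r - 1).prod = 0 :=
    Multiset.prod_eq_zero (Multiset.mem_map.mpr ⟨b, hb, by rw [h1, sub_self]⟩)
  rw [h0] at h
  exact (algebraMap ℤ L).injective_int (by rw [h, map_zero])

end Resultant

/-! ### `kerNorm_ℓ(P, X^r - 1) = |Res(P, X^r - 1)|_ℓ⁻¹` -/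

section KerNorm

variable {p : ℕ} [hp : Fact p.Prime]

/-- The roots of `P ∈ ℤ[X]` in `\overline{ℚ_p}` through `ℤ → ℤ_p → \overline{ℚ_p}`. [folklore] -/
theorem roots_map_map (P : ℤ[X]) :
    ((P.map (Int.castRingHom ℤ_[p])).map (algebraMap ℤ_[p] (PadicAlgCl p))).roots =
      (P.map (algebraMap ℤ (PadicAlgCl p))).roots := by
  rw [Polynomial.map_map, RingHom.ext_int ((algebraMap ℤ_[p] (PadicAlgCl p)).comp (Int.castRingHom ℤ_[p]))
    (algebraMap ℤ (PadicAlgCl p))]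

/-- `Res(P, X^r - 1) = ∏_{P(β)=0} (β^r - 1)` in `\overline{ℚ_p}` (the instance of
`algebraMap_resultant_X_pow_sub_one`, restated so that rewriting matches syntactically). [folklore] -/
theorem algebraMap_resultant_X_pow_sub_one_padic {P : ℤ[X]} (hP : P.Monic) {N : ℕ} (hPN : P.natDegree = N)
    {r : ℕ} (hr : 0 < r) :
    algebraMap ℤ (PadicAlgCl p) (Polynomial.resultant P (X ^ r - 1) N r) =
      ((P.map (algebraMap ℤ (PadicAlgCl p))).roots.map fun b => b ^ r - 1).prod :=
  algebraMap_resultant_X_pow_sub_one (L := PadicAlgCl p) hP hPN hr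

/-- `kerNorm_p(P, X^r - 1) = ∏_{P(β)=0} |β^r - 1|_p⁻¹`. [folklore] -/
theorem kerNorm_map_X_pow_sub_one (P : ℤ[X]) (r : ℕ) :
    kerNorm (P.map (Int.castRingHom ℤ_[p])) (X ^ r - 1) =
      ((P.map (algebraMap ℤ (PadicAlgCl p))).roots.map fun b => ‖b ^ r - 1‖⁻¹).prod := by
  rw [kerNorm, roots_map_map]
  refine congrArg _ (Multiset.map_congr rfl fun b _ => ?_)
  rw [map_sub, map_pow, aeval_X, map_one]

/-- An integer in `\overline{ℚ_p}` has the `p`-adic norm of its image in `ℚ_p`. [folklore] -/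
theorem norm_algebraMap_int (z : ℤ) : ‖algebraMap ℤ (PadicAlgCl p) z‖ = ‖(z : ℚ_[p])‖ := by
  rw [show algebraMap ℤ (PadicAlgCl p) z = ((z : ℚ_[p]) : PadicAlgCl p) by simp, PadicAlgCl.norm_extends p]

/-- **`kerNorm_p(P, X^r - 1) = |Res(P, X^r - 1)|_p⁻¹`** for `P ∈ ℤ[X]` monic of degree `N` and `r ≥ 1`.
[folklore] -/
theorem kerNorm_map_X_pow_sub_one_eq {P : ℤ[X]} (hP : P.Monic) {N : ℕ} (hPN : P.natDegree = N)
    {r : ℕ} (hr : 0 < r) :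
    kerNorm (P.map (Int.castRingHom ℤ_[p])) (X ^ r - 1) =
      ‖((Polynomial.resultant P (X ^ r - 1) N r : ℤ) : ℚ_[p])‖⁻¹ := by
  rw [kerNorm_map_X_pow_sub_one, Multiset.prod_map_inv, ← norm_algebraMap_int,
    algebraMap_resultant_X_pow_sub_one_padic hP hPN hr]
  congr 1
  change _ = (normHom : PadicAlgCl p →*₀ ℝ) _
  rw [map_multiset_prod, Multiset.map_map]
  rfl

/-- `|p|`-adic valuation bookkeeping: for a non-zero integer `z`, `‖z‖_p⁻¹ = p^{v_p(z)}` as a real number.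
[folklore] -/
theorem inv_norm_intCast_eq_pow {z : ℤ} (hz : z ≠ 0) :
    ‖(z : ℚ_[p])‖⁻¹ = (p : ℝ) ^ (z.natAbs.factorization p) := by
  rw [EllipticCurves.TateModule.norm_intCast_padic_eq hz, inv_inv, Nat.factorization_def _ hp.out]
  rfl

/-- From `ℓ^v = kerNorm_ℓ(P, X^r - 1)`: the resultant is non-zero and `v = v_ℓ(Res(P, X^r - 1))`.
[folklore] -/
theorem resultant_ne_zero_and_eq_factorization {P : ℤ[X]} (hP : P.Monic) {N : ℕ} (hPN : P.natDegree = N)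
    {r : ℕ} (hr : 0 < r) {v : ℕ}
    (hv : ((p : ℝ) ^ v) = kerNorm (P.map (Int.castRingHom ℤ_[p])) (X ^ r - 1)) :
    Polynomial.resultant P (X ^ r - 1) N r ≠ 0 ∧
      v = (Polynomial.resultant P (X ^ r - 1) N r).natAbs.factorization p := by
  rw [kerNorm_map_X_pow_sub_one_eq hP hPN hr] at hv
  have hR : Polynomial.resultant P (X ^ r - 1) N r ≠ 0 := by
    intro h0
    rw [h0, Int.cast_zero, norm_zero, inv_zero] at hv
    exact pow_ne_zero v (Nat.cast_ne_zero.mpr hp.out.ne_zero) hv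
  refine ⟨hR, ?_⟩
  rw [inv_norm_intCast_eq_pow hR] at hv
  have h1 : (1 : ℝ) < p := by exact_mod_cast hp.out.one_lt
  exact pow_right_injective₀ (by positivity) h1.ne' hv

end KerNorm

/-! ### `kerNorm_p(Q_p, F) ≤ kerNorm_p(P, F)` for a sub-multiset of roots -/

section SubMultiset

variable {p : ℕ} [hp : Fact p.Prime]

/-- A product of reals `≥ 1` over a multiset is `≥ 1`. [folklore] -/
private theorem one_le_prod_map {α : Type*} (s : Multiset α) {f : α → ℝ} (h : ∀ x ∈ s, 1 ≤ f x) :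
    1 ≤ (s.map f).prod := by
  induction s using Multiset.induction_on with
  | empty => simp
  | cons a s ih =>
    rw [Multiset.map_cons, Multiset.prod_cons]
    exact one_le_mul_of_one_le_of_one_le (h a (Multiset.mem_cons_self a s))
      (ih fun x hx => h x (Multiset.mem_cons_of_mem hx))

/-- A product of nonnegative reals over a multiset is nonnegative. [folklore] -/
private theorem prod_map_nonneg' {α : Type*} (s : Multiset α) {f : α → ℝ} (h : ∀ x ∈ s, 0 ≤ f x) :
    0 ≤ (s.map f).prod :=
  Multiset.prod_nonneg fun x hx => by
    obtain ⟨a, ha, rfl⟩ := Multiset.mem_map.mp hx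
    exact h a ha

/-- `kerNorm Q F` split along a decomposition of the roots. [folklore] -/
theorem kerNorm_eq_mul_of_roots_eq {Q : ℤ_[p][X]} {s u : Multiset (PadicAlgCl p)}
    (h : (Q.map (algebraMap ℤ_[p] (PadicAlgCl p))).roots = s + u) (F : ℤ[X]) :
    kerNorm Q F = (s.map fun b => ‖aeval b F‖⁻¹).prod * (u.map fun b => ‖aeval b F‖⁻¹).prod := by
  rw [kerNorm, h, Multiset.map_add, Multiset.prod_add]

/-- **`kerNorm_p(Q_p, F) ≤ kerNorm_p(P, F)`** when the roots of the monic `Q_p ∈ ℤ_p[X]` form a sub-multiset of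
the roots of the monic `P ∈ ℤ[X]` in `\overline{ℚ_p}` and `F` vanishes at no root of `P`: the extra factors
`|F(β)|_p⁻¹` are `≥ 1` since `|F(β)|_p ≤ 1` (integrality). [folklore] -/
theorem kerNorm_le_kerNorm_of_roots_le {P : ℤ[X]} (hP : P.Monic) {Qp : ℤ_[p][X]}
    (hle : (Qp.map (algebraMap ℤ_[p] (PadicAlgCl p))).roots ≤
      ((P.map (Int.castRingHom ℤ_[p])).map (algebraMap ℤ_[p] (PadicAlgCl p))).roots)
    (F : ℤ[X]) (hF : ∀ b ∈ ((P.map (Int.castRingHom ℤ_[p])).map (algebraMap ℤ_[p] (PadicAlgCl p))).roots,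
      aeval b F ≠ 0) :
    kerNorm Qp F ≤ kerNorm (P.map (Int.castRingHom ℤ_[p])) F := by
  obtain ⟨u, hu⟩ := Multiset.le_iff_exists_add.mp hle
  rw [kerNorm_eq_mul_of_roots_eq hu F, ← kerNorm]
  have hPm : (P.map (Int.castRingHom ℤ_[p])).Monic := hP.map _
  refine le_mul_of_one_le_right (prod_map_nonneg' _ fun b _ => inv_nonneg.mpr (norm_nonneg _))
    (one_le_prod_map u fun b hb => ?_)
  have hbP : b ∈ ((P.map (Int.castRingHom ℤ_[p])).map (algebraMap ℤ_[p] (PadicAlgCl p))).roots := by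
    rw [hu]; exact Multiset.mem_add.mpr (Or.inr hb)
  have hb1 : ‖b‖ ≤ 1 := PadicInt.norm_le_one_of_mem_roots_map hPm hbP
  have hle1 : ‖aeval b F‖ ≤ 1 := norm_aeval_le_one F hb1
  have hpos : 0 < ‖aeval b F‖ := norm_pos_iff.mpr (hF b hbP)
  exact (one_le_inv₀ hpos).mpr hle1

end SubMultiset

/-! ### The `p`-adic size of `Res(P, X^r - 1)` grows at most polynomially in `r` -/

section PadicBound

variable {p : ℕ} [hp : Fact p.Prime]

/-- A uniform separation constant for the finitely many roots of `P`: if no root of `P` in `\overline{ℚ_p}` is a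
root of unity, one `c > 0` lies below all `|β - ζ|_p` (`β` a root of `P`, `ζ` a root of unity). [folklore] -/
theorem exists_pos_forall_roots_le_norm_sub (P : ℤ[X])
    (hP : ∀ b ∈ (P.map (algebraMap ℤ (PadicAlgCl p))).roots, ∀ n : ℕ, 0 < n → b ^ n ≠ 1) :
    ∃ c : ℝ, 0 < c ∧ ∀ b ∈ (P.map (algebraMap ℤ (PadicAlgCl p))).roots,
      ∀ (ζ : PadicAlgCl p) (n : ℕ), 0 < n → ζ ^ n = 1 → c ≤ ‖b - ζ‖ := by
  set B := (P.map (algebraMap ℤ (PadicAlgCl p))).roots with hB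
  -- a constant for each root
  have key : ∀ b ∈ B.toFinset, ∃ c : ℝ, 0 < c ∧ ∀ (ζ : PadicAlgCl p) (n : ℕ), 0 < n → ζ ^ n = 1 → c ≤ ‖b - ζ‖ :=
    fun b hb => exists_pos_le_norm_sub (hP b (Multiset.mem_toFinset.mp hb))
  choose! cf hcf_pos hcf using key
  by_cases hne : B.toFinset.Nonempty
  · obtain ⟨b₀, hb₀, hmin⟩ := Finset.exists_min_image B.toFinset cf hne
    refine ⟨cf b₀, hcf_pos b₀ hb₀, fun b hb ζ n hn hζ => ?_⟩
    have hb' : b ∈ B.toFinset := Multiset.mem_toFinset.mpr hb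
    exact (hmin b hb').trans (hcf b hb' ζ n hn hζ)
  · refine ⟨1, one_pos, fun b hb => ?_⟩
    exact absurd ⟨b, Multiset.mem_toFinset.mpr hb⟩ hne

/-- **`p^{v_p(Res(P, X^r - 1))} ≤ C · r^N`** for a monic `P ∈ ℤ[X]` of degree `N` all of whose resultants with
the `X^r - 1` are non-zero: in `\overline{ℚ_p}`, `Res = ∏_β ∏_{ζ^r = 1} (β - ζ)` and
`∏_{ζ^r=1} |β - ζ| ≥ c |r|_p ≥ c / r` (`PadicRootsOfUnity.mul_norm_natCast_le_prod_norm_sub`). [folklore] -/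
theorem exists_pow_padicValInt_resultant_le {P : ℤ[X]} (hP : P.Monic) {N : ℕ} (hPN : P.natDegree = N)
    (hR : ∀ r : ℕ, 0 < r → Polynomial.resultant P (X ^ r - 1) N r ≠ 0) :
    ∃ C : ℝ, 0 < C ∧ ∀ r : ℕ, 0 < r →
      (p : ℝ) ^ ((Polynomial.resultant P (X ^ r - 1) N r).natAbs.factorization p) ≤ C * (r : ℝ) ^ N := by
  set B := (P.map (algebraMap ℤ (PadicAlgCl p))).roots with hB
  have hcardB : Multiset.card B = N := by
    rw [hB, ← (IsAlgClosed.splits _).natDegree_eq_card_roots, hP.natDegree_map, hPN]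
  have hBunit : ∀ b ∈ B, ∀ n : ℕ, 0 < n → b ^ n ≠ 1 := fun b hb n hn =>
    pow_ne_one_of_resultant_ne_zero hP hPN hn (hR n hn) hb
  obtain ⟨c, hc, hcB⟩ := exists_pos_forall_roots_le_norm_sub P hBunit
  refine ⟨(c⁻¹) ^ N, by positivity, fun r hr => ?_⟩
  -- `|Res| = ∏_β ∏_ζ |β - ζ|`
  have hres : ‖algebraMap ℤ (PadicAlgCl p) (Polynomial.resultant P (X ^ r - 1) N r)‖ =
      (B.map fun b => (((X ^ r - 1 : (PadicAlgCl p)[X])).roots.map fun ζ => ‖b - ζ‖).prod).prod := by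
    rw [algebraMap_resultant_X_pow_sub_one_padic hP hPN hr, ← hB]
    change (normHom : PadicAlgCl p →*₀ ℝ) _ = _
    rw [map_multiset_prod, Multiset.map_map]
    refine congrArg _ (Multiset.map_congr rfl fun b _ => ?_)
    change ‖b ^ r - 1‖ = _
    rw [← prod_roots_X_pow_sub_one_sub hr b]
    change (normHom : PadicAlgCl p →*₀ ℝ) _ = _
    rw [map_multiset_prod, Multiset.map_map]
    rfl
  -- the roots of `X^r - 1` are the `nthRoots r 1`
  have hroots : (X ^ r - 1 : (PadicAlgCl p)[X]).roots = nthRoots r (1 : PadicAlgCl p) := by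
    rw [nthRoots, C_1]
  -- lower bound for each root of `P`
  have hlow : ∀ b ∈ B, c * ‖(r : PadicAlgCl p)‖ ≤ (((X ^ r - 1 : (PadicAlgCl p)[X])).roots.map fun ζ => ‖b - ζ‖).prod :=
    fun b hb => by rw [hroots]; exact mul_norm_natCast_le_prod_norm_sub (hcB b hb) hr
  have hcr : 0 < c * ‖(r : PadicAlgCl p)‖ :=
    mul_pos hc ((inv_pos.mpr (by exact_mod_cast hr)).trans_le (inv_natCast_le_norm_natCast hr))
  have hprod : (c * ‖(r : PadicAlgCl p)‖) ^ N ≤ ‖algebraMap ℤ (PadicAlgCl p) (Polynomial.resultant P (X ^ r - 1) N r)‖ := by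
    rw [hres, ← hcardB]
    exact pow_card_le_prod_map B hcr.le hlow
  -- invert
  rw [← inv_norm_intCast_eq_pow (hR r hr), ← norm_algebraMap_int]
  have h1 : ‖algebraMap ℤ (PadicAlgCl p) (Polynomial.resultant P (X ^ r - 1) N r)‖⁻¹ ≤ ((c * ‖(r : PadicAlgCl p)‖) ^ N)⁻¹ :=
    inv_anti₀ (pow_pos hcr N) hprod
  refine h1.trans ?_
  rw [← inv_pow, mul_inv, mul_pow]
  refine mul_le_mul_of_nonneg_left ?_ (by positivity)
  have h2 : ‖(r : PadicAlgCl p)‖⁻¹ ≤ r := by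
    have := inv_natCast_le_norm_natCast (p := p) hr
    calc ‖(r : PadicAlgCl p)‖⁻¹ ≤ ((r : ℝ)⁻¹)⁻¹ := inv_anti₀ (by positivity) this
      _ = r := inv_inv _
  exact pow_le_pow_left₀ (inv_nonneg.mpr (norm_nonneg _)) h2 N

end PadicBound

/-! ### Unique factorization: `|Res| = h · p^{a}` -/

section Factorization

/-- If two non-zero natural numbers have the same `ℓ`-adic valuation at every prime `ℓ ≠ p`, and `v_p(n) ≤ v_p(m)`,
then `m = n · p^{v_p(m) - v_p(n)}`. [folklore] -/
theorem eq_mul_pow_of_factorization_eq {m n p : ℕ} (hm : m ≠ 0) (hn : n ≠ 0) (hp : p.Prime)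
    (hℓ : ∀ ℓ : ℕ, ℓ.Prime → ℓ ≠ p → m.factorization ℓ = n.factorization ℓ)
    (hple : n.factorization p ≤ m.factorization p) :
    m = n * p ^ (m.factorization p - n.factorization p) := by
  refine Nat.eq_of_factorization_eq hm (mul_ne_zero hn (pow_ne_zero _ hp.ne_zero)) fun ℓ => ?_
  rw [Nat.factorization_mul hn (pow_ne_zero _ hp.ne_zero), hp.factorization_pow, Finsupp.add_apply,
    Finsupp.single_apply]
  by_cases hℓp : p = ℓ
  · subst hℓp
    rw [if_pos rfl]
    omega
  · rw [if_neg hℓp, add_zero]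
    by_cases hℓ' : ℓ.Prime
    · exact hℓ ℓ hℓ' (Ne.symm hℓp)
    · rw [Nat.factorization_eq_zero_of_not_prime _ hℓ', Nat.factorization_eq_zero_of_not_prime _ hℓ']

end Factorization

/-! ### The main `p`-adic bookkeeping: `|R_r| = h_r · p^{a_r}` -/

section Main

variable {p : ℕ} [hp : Fact p.Prime]

/-- **`|Res(P, X^r - 1)| = h_r · kerNorm_p(P, X^r - 1) / kerNorm_p(Q_p, X^r - 1)`**, the quotient being a power of
`p` with non-negative exponent.  Hypotheses: `P ∈ ℤ[X]` monic of degree `N`; `h_r ≥ 1`; for every prime `ℓ ≠ p`,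
`ℓ^{v_ℓ(h_r)} = kerNorm_ℓ(P, X^r - 1)`; `Q_p ∈ ℤ_p[X]` monic with roots among those of `P`, and
`p^{v_p(h_r)} = kerNorm_p(Q_p, X^r - 1)`.  (For the Frobenius of an abelian variety: `h_r = #A(𝔽_{q^r})`, and these are
the `ℓ`-primary decompositions of the kernel of `π^r - 1`.) [folklore] -/
theorem natAbs_resultant_eq_mul_div {P : ℤ[X]} (hP : P.Monic) {N : ℕ} (hPN : P.natDegree = N)
    {r : ℕ} (hr : 0 < r) {h : ℕ} (hh : h ≠ 0)
    (hℓ : ∀ (ℓ : ℕ) [Fact ℓ.Prime], ℓ ≠ p →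
      ((ℓ : ℝ) ^ (h.factorization ℓ)) = kerNorm (P.map (Int.castRingHom ℤ_[ℓ])) (X ^ r - 1))
    {Qp : ℤ_[p][X]}
    (hle : (Qp.map (algebraMap ℤ_[p] (PadicAlgCl p))).roots ≤
      ((P.map (Int.castRingHom ℤ_[p])).map (algebraMap ℤ_[p] (PadicAlgCl p))).roots)
    (hpv : ((p : ℝ) ^ (h.factorization p)) = kerNorm Qp (X ^ r - 1)) :
    Polynomial.resultant P (X ^ r - 1) N r ≠ 0 ∧
      0 < kerNorm Qp (X ^ r - 1) ∧
      (∃ a : ℕ, a ≤ (Polynomial.resultant P (X ^ r - 1) N r).natAbs.factorization p ∧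
        kerNorm (P.map (Int.castRingHom ℤ_[p])) (X ^ r - 1) / kerNorm Qp (X ^ r - 1) = (p : ℝ) ^ a) ∧
      ((Polynomial.resultant P (X ^ r - 1) N r).natAbs : ℝ) =
        h * (kerNorm (P.map (Int.castRingHom ℤ_[p])) (X ^ r - 1) / kerNorm Qp (X ^ r - 1)) := by
  -- an auxiliary prime `ℓ₀ ≠ p` shows `Res ≠ 0`
  obtain ⟨ℓ₀, hℓ₀p, hℓ₀⟩ := Nat.exists_infinite_primes (p + 1)
  haveI : Fact ℓ₀.Prime := ⟨hℓ₀⟩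
  have hne₀ : ℓ₀ ≠ p := by omega
  set R := Polynomial.resultant P (X ^ r - 1) N r with hRdef
  have hR : R ≠ 0 := (resultant_ne_zero_and_eq_factorization (p := ℓ₀) hP hPN hr (hℓ ℓ₀ hne₀)).1
  -- valuations at `ℓ ≠ p`
  have hvalℓ : ∀ ℓ : ℕ, ℓ.Prime → ℓ ≠ p → R.natAbs.factorization ℓ = h.factorization ℓ := by
    intro ℓ hℓprime hne
    haveI : Fact ℓ.Prime := ⟨hℓprime⟩
    exact ((resultant_ne_zero_and_eq_factorization (p := ℓ) hP hPN hr (hℓ ℓ hne)).2).symm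
  -- at `p`
  have hkerP : kerNorm (P.map (Int.castRingHom ℤ_[p])) (X ^ r - 1) = (p : ℝ) ^ (R.natAbs.factorization p) := by
    rw [kerNorm_map_X_pow_sub_one_eq hP hPN hr, ← hRdef, inv_norm_intCast_eq_pow hR]
  have hF : ∀ b ∈ ((P.map (Int.castRingHom ℤ_[p])).map (algebraMap ℤ_[p] (PadicAlgCl p))).roots,
      aeval b (X ^ r - 1 : ℤ[X]) ≠ 0 := by
    intro b hb
    rw [roots_map_map] at hb
    rw [map_sub, map_pow, aeval_X, map_one, sub_ne_zero]
    exact pow_ne_one_of_resultant_ne_zero hP hPN hr hR hb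
  have hQle : kerNorm Qp (X ^ r - 1) ≤ kerNorm (P.map (Int.castRingHom ℤ_[p])) (X ^ r - 1) :=
    kerNorm_le_kerNorm_of_roots_le hP hle _ hF
  have hp1 : (1 : ℝ) < p := by exact_mod_cast hp.out.one_lt
  have hvalp : h.factorization p ≤ R.natAbs.factorization p := by
    rw [← pow_le_pow_iff_right₀ hp1, hpv, ← hkerP]
    exact hQle
  have hQpos : 0 < kerNorm Qp (X ^ r - 1) := by rw [← hpv]; positivity
  -- the factorization identity
  have hnat : R.natAbs = h * p ^ (R.natAbs.factorization p - h.factorization p) :=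
    eq_mul_pow_of_factorization_eq (Int.natAbs_ne_zero.mpr hR) hh hp.out hvalℓ hvalp
  have hquot : kerNorm (P.map (Int.castRingHom ℤ_[p])) (X ^ r - 1) / kerNorm Qp (X ^ r - 1) =
      (p : ℝ) ^ (R.natAbs.factorization p - h.factorization p) := by
    rw [hkerP, ← hpv, pow_sub₀ _ (by positivity) hvalp, div_eq_mul_inv]
  refine ⟨hR, hQpos, ⟨_, Nat.sub_le _ _, hquot⟩, ?_⟩
  have hcast := congrArg (Nat.cast : ℕ → ℝ) hnat
  push_cast at hcast
  rw [hquot]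
  exact hcast

/-! ### The tower argument -/

/-- `|p| < 1` in `\overline{ℚ_p}`. [folklore] -/
private theorem norm_p_lt_one' : ‖(p : PadicAlgCl p)‖ < 1 := by
  rw [← map_natCast (algebraMap ℤ_[p] (PadicAlgCl p)) p, PadicInt.norm_algebraMap_padicAlgCl,
    _root_.PadicInt.norm_p]
  exact inv_lt_one_of_one_lt₀ (by exact_mod_cast hp.out.one_lt)

/-- **Pigeonhole in `ℤ_p[X]/(Q, p)`**: for a monic `Q ∈ ℤ_p[X]` of positive degree and a root `b` of `Q` in
`\overline{ℚ_p}` of norm `1`, some power `b^d` (`d ≥ 1`) is congruent to `1`: `|b^d - 1|_p < 1`.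
(Two of the powers `X^0, …, X^{p^e}` agree modulo `(Q, p)`.) [folklore] -/
theorem exists_norm_pow_sub_one_lt_one {Q : ℤ_[p][X]} (hQ : Q.Monic) (hQ1 : 0 < Q.natDegree)
    {b : PadicAlgCl p} (hb : aeval b Q = 0) (hb1 : ‖b‖ = 1) :
    ∃ d : ℕ, 0 < d ∧ ‖b ^ d - 1‖ < 1 := by
  haveI : NeZero (p ^ 1) := ⟨pow_ne_zero _ hp.out.ne_zero⟩
  let f : Fin (p ^ Q.natDegree + 1) → (Fin Q.natDegree → ZMod (p ^ 1)) :=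
    fun k => redMod Q 1 (X ^ (k : ℕ) : ℤ[X])
  have hcard : Fintype.card (Fin Q.natDegree → ZMod (p ^ 1)) < Fintype.card (Fin (p ^ Q.natDegree + 1)) := by
    simp only [Fintype.card_fun, ZMod.card, Fintype.card_fin, pow_one]
    exact Nat.lt_succ_self _
  obtain ⟨k₁, k₂, hne, heq⟩ := Fintype.exists_ne_map_eq_of_card_lt f hcard
  -- `|b^{k₁} - b^{k₂}| ≤ p⁻¹`
  have hsmall : ∀ {i j : Fin (p ^ Q.natDegree + 1)}, f i = f j → ‖b ^ (i : ℕ) - b ^ (j : ℕ)‖ < 1 := by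
    intro i j hij
    obtain ⟨H, hH⟩ := exists_modByMonic_eq_of_redMod_eq hQ hQ1 hij
    have h := norm_aeval_le_of_modByMonic_eq hQ hH hb
    rw [map_sub, map_pow, map_pow, aeval_X] at h
    refine h.trans_lt ?_
    rw [zpow_neg, zpow_natCast, pow_one]
    exact inv_lt_one_of_one_lt₀ (by exact_mod_cast hp.out.one_lt)
  -- order the two exponents
  rcases lt_or_gt_of_ne (Fin.val_injective.ne hne) with hlt | hlt
  · refine ⟨(k₂ : ℕ) - k₁, Nat.sub_pos_of_lt hlt, ?_⟩
    have h := hsmall heq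
    have hfac : b ^ (k₁ : ℕ) - b ^ (k₂ : ℕ) = -(b ^ (k₁ : ℕ) * (b ^ ((k₂ : ℕ) - k₁) - 1)) := by
      rw [mul_sub, mul_one, ← pow_add, Nat.add_sub_cancel' hlt.le, neg_sub]
    rwa [hfac, norm_neg, norm_mul, norm_pow, hb1, one_pow, one_mul] at h
  · refine ⟨(k₁ : ℕ) - k₂, Nat.sub_pos_of_lt hlt, ?_⟩
    have h := hsmall heq.symm
    have hfac : b ^ (k₂ : ℕ) - b ^ (k₁ : ℕ) = -(b ^ (k₂ : ℕ) * (b ^ ((k₁ : ℕ) - k₂) - 1)) := by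
      rw [mul_sub, mul_one, ← pow_add, Nat.add_sub_cancel' hlt.le, neg_sub]
    rwa [hfac, norm_neg, norm_mul, norm_pow, hb1, one_pow, one_mul] at h

/-- `|(1 + y)^p - 1| ≤ |y| · max(|p|, |y|)` for `|y| ≤ 1`. [folklore] -/
theorem norm_one_add_pow_prime_sub_one_le {y : PadicAlgCl p} (hy : ‖y‖ ≤ 1) :
    ‖(1 + y) ^ p - 1‖ ≤ ‖y‖ * max ‖(p : PadicAlgCl p)‖ ‖y‖ := by
  obtain ⟨w, hw, hid⟩ := exists_one_add_pow_sub_one_eq hy p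
  rw [hid, norm_mul]
  refine mul_le_mul_of_nonneg_left ?_ (norm_nonneg _)
  refine (IsUltrametricDist.norm_add_le_max _ _).trans (max_le_max le_rfl ?_)
  rw [norm_mul]
  exact mul_le_of_le_one_right (norm_nonneg _) hw

/-- **Geometric decay along the `p`-power tower**: `|b^{d p^t} - 1| ≤ |b^d - 1| · θ^t` with
`θ = max(|p|, |b^d - 1|)` (for `|b^d - 1| ≤ 1`). [folklore] -/
theorem norm_pow_mul_prime_pow_sub_one_le {b : PadicAlgCl p} {d : ℕ} (h1 : ‖b ^ d - 1‖ ≤ 1) (t : ℕ) :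
    ‖b ^ (d * p ^ t) - 1‖ ≤ ‖b ^ d - 1‖ * (max ‖(p : PadicAlgCl p)‖ ‖b ^ d - 1‖) ^ t := by
  induction t with
  | zero => simp
  | succ t ih =>
    have hθ1 : max ‖(p : PadicAlgCl p)‖ ‖b ^ d - 1‖ ≤ 1 := max_le (norm_natCast_le_one p) h1
    -- `y_t`
    set y := b ^ (d * p ^ t) - 1 with hy
    have hyt : ‖y‖ ≤ ‖b ^ d - 1‖ := by
      refine ih.trans ?_
      exact mul_le_of_le_one_right (norm_nonneg _) (pow_le_one₀ (le_max_of_le_left (norm_nonneg _)) hθ1)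
    have hy1 : ‖y‖ ≤ 1 := hyt.trans h1
    have hstep : b ^ (d * p ^ (t + 1)) - 1 = (1 + y) ^ p - 1 := by
      rw [hy, add_sub_cancel, ← pow_mul, pow_succ, mul_assoc]
    rw [hstep]
    calc ‖(1 + y) ^ p - 1‖ ≤ ‖y‖ * max ‖(p : PadicAlgCl p)‖ ‖y‖ := norm_one_add_pow_prime_sub_one_le hy1
      _ ≤ ‖y‖ * max ‖(p : PadicAlgCl p)‖ ‖b ^ d - 1‖ :=
          mul_le_mul_of_nonneg_left (max_le_max le_rfl hyt) (norm_nonneg _)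
      _ ≤ (‖b ^ d - 1‖ * (max ‖(p : PadicAlgCl p)‖ ‖b ^ d - 1‖) ^ t) * max ‖(p : PadicAlgCl p)‖ ‖b ^ d - 1‖ :=
          mul_le_mul_of_nonneg_right ih (le_max_of_le_left (norm_nonneg _))
      _ = ‖b ^ d - 1‖ * (max ‖(p : PadicAlgCl p)‖ ‖b ^ d - 1‖) ^ (t + 1) := by rw [pow_succ]; ring

/-- An element of norm `< 1` has all its powers at distance `1` from `1`. [folklore] -/
theorem norm_pow_sub_one_eq_one {b : PadicAlgCl p} (hb : ‖b‖ < 1) {r : ℕ} (hr : 0 < r) : ‖b ^ r - 1‖ = 1 := by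
  have h : ‖b ^ r‖ < ‖(-1 : PadicAlgCl p)‖ := by
    rw [norm_neg, norm_one, norm_pow]; exact pow_lt_one₀ (norm_nonneg _) hb hr.ne'
  rw [sub_eq_add_neg, IsUltrametricDist.norm_add_eq_max_of_norm_ne_norm h.ne, max_eq_right h.le, norm_neg, norm_one]

/-- **The tower argument.**  Let `P ∈ ℤ[X]` be monic of positive degree `N` with `Res(P, X^r - 1) ≠ 0` for all
`r ≥ 1`, and let the monic `Q_p ∈ ℤ_p[X]` have its roots among those of `P` in `\overline{ℚ_p}`.  If the quotients
`kerNorm_p(P, X^r - 1) / kerNorm_p(Q_p, X^r - 1)` (`r ≥ 1`) are bounded, then they are all equal to `1`.  Indeed a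
root `β₀` of `P` outside the roots of `Q_p` with `|β₀| = 1` would have `|β₀^d - 1| < 1` for some `d ≥ 1`
(`exists_norm_pow_sub_one_lt_one`), hence `|β₀^{d p^t} - 1| → 0` geometrically, and the quotient at `r = d p^t`
is at least `|β₀^{d p^t} - 1|⁻¹`; so all those roots have `|β| < 1`, and then `|β^r - 1| = 1`. [folklore] -/
theorem kerNorm_eq_kerNorm_of_bounded {P : ℤ[X]} (hP : P.Monic) {N : ℕ} (hPN : P.natDegree = N) (hN : 0 < N)
    (hR : ∀ r : ℕ, 0 < r → Polynomial.resultant P (X ^ r - 1) N r ≠ 0) {Qp : ℤ_[p][X]}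
    (hle : (Qp.map (algebraMap ℤ_[p] (PadicAlgCl p))).roots ≤
      ((P.map (Int.castRingHom ℤ_[p])).map (algebraMap ℤ_[p] (PadicAlgCl p))).roots)
    {C : ℝ} (hC : ∀ r : ℕ, 0 < r →
      kerNorm (P.map (Int.castRingHom ℤ_[p])) (X ^ r - 1) ≤ C * kerNorm Qp (X ^ r - 1)) :
    ∀ r : ℕ, 0 < r → kerNorm (P.map (Int.castRingHom ℤ_[p])) (X ^ r - 1) = kerNorm Qp (X ^ r - 1) := by
  set Pp := P.map (Int.castRingHom ℤ_[p]) with hPp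
  have hPpm : Pp.Monic := hP.map _
  have hPp1 : 0 < Pp.natDegree := by rw [hPp, hP.natDegree_map, hPN]; exact hN
  obtain ⟨u, hu⟩ := Multiset.le_iff_exists_add.mp hle
  -- the roots of `P`, and `F_r = X^r - 1` on them
  have hmemP : ∀ b ∈ u, b ∈ (Pp.map (algebraMap ℤ_[p] (PadicAlgCl p))).roots := fun b hb => by
    rw [hu]; exact Multiset.mem_add.mpr (Or.inr hb)
  have hmemQ : ∀ b ∈ (Qp.map (algebraMap ℤ_[p] (PadicAlgCl p))).roots,
      b ∈ (Pp.map (algebraMap ℤ_[p] (PadicAlgCl p))).roots := fun b hb => by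
    rw [hu]; exact Multiset.mem_add.mpr (Or.inl hb)
  have hrootP : ∀ b ∈ (Pp.map (algebraMap ℤ_[p] (PadicAlgCl p))).roots, aeval b Pp = 0 := fun b hb => by
    have h := (mem_roots ((hPpm.map _).ne_zero)).mp hb
    rwa [IsRoot.def, eval_map_algebraMap] at h
  have hne1 : ∀ b ∈ (Pp.map (algebraMap ℤ_[p] (PadicAlgCl p))).roots, ∀ r : ℕ, 0 < r → b ^ r ≠ 1 := by
    intro b hb r hr
    rw [hPp, roots_map_map] at hb
    exact pow_ne_one_of_resultant_ne_zero hP hPN hr (hR r hr) hb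
  have haeval : ∀ (b : PadicAlgCl p) (r : ℕ), aeval b (X ^ r - 1 : ℤ[X]) = b ^ r - 1 := fun b r => by
    rw [map_sub, map_pow, aeval_X, map_one]
  -- factors `≥ 1` on the roots of `P`
  have hge1 : ∀ b ∈ (Pp.map (algebraMap ℤ_[p] (PadicAlgCl p))).roots, ∀ r : ℕ, 0 < r →
      1 ≤ ‖aeval b (X ^ r - 1 : ℤ[X])‖⁻¹ := by
    intro b hb r hr
    have hb1 : ‖b‖ ≤ 1 := PadicInt.norm_le_one_of_mem_roots_map hPpm hb
    have hpos : 0 < ‖aeval b (X ^ r - 1 : ℤ[X])‖ := by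
      rw [haeval, norm_pos_iff, sub_ne_zero]; exact hne1 b hb r hr
    exact (one_le_inv₀ hpos).mpr (norm_aeval_le_one _ hb1)
  have hQpos : ∀ r : ℕ, 0 < r → 0 < kerNorm Qp (X ^ r - 1) := fun r hr =>
    Multiset.prod_pos fun x hx => by
      obtain ⟨b, hb, rfl⟩ := Multiset.mem_map.mp hx
      exact one_pos.trans_le (hge1 b (hmemQ b hb) r hr)
  -- every root outside `Q_p` has norm `< 1`
  have hsmall : ∀ b ∈ u, ‖b‖ < 1 := by
    intro b₀ hb₀
    have hb₀P := hmemP b₀ hb₀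
    have hle1 : ‖b₀‖ ≤ 1 := PadicInt.norm_le_one_of_mem_roots_map hPpm hb₀P
    by_contra hnot
    have hb₀1 : ‖b₀‖ = 1 := le_antisymm hle1 (not_lt.mp hnot)
    obtain ⟨d, hd, hd1⟩ := exists_norm_pow_sub_one_lt_one hPpm hPp1 (hrootP b₀ hb₀P) hb₀1
    set y₀ := b₀ ^ d - 1 with hy₀
    set θ := max ‖(p : PadicAlgCl p)‖ ‖y₀‖ with hθ
    have hθ1 : θ < 1 := max_lt norm_p_lt_one' hd1
    have hθ0 : 0 ≤ θ := le_max_of_le_right (norm_nonneg _)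
    have hy₀pos : 0 < ‖y₀‖ := by
      rw [hy₀, norm_pos_iff, sub_ne_zero]; exact hne1 b₀ hb₀P d hd
    -- the quotient at `r = d p^t` is at least `(‖y₀‖ θ^t)⁻¹`
    have hkey : ∀ t : ℕ, 1 ≤ C * (‖y₀‖ * θ ^ t) := by
      intro t
      have hrt : 0 < d * p ^ t := Nat.mul_pos hd (pow_pos hp.out.pos t)
      set F : ℤ[X] := X ^ (d * p ^ t) - 1 with hF
      have hdec := kerNorm_eq_mul_of_roots_eq hu F
      rw [← kerNorm] at hdec
      -- `∏_u ≥ ‖F(b₀)‖⁻¹`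
      have hu1 : ‖aeval b₀ F‖⁻¹ ≤ (u.map fun b => ‖aeval b F‖⁻¹).prod := by
        rw [← Multiset.cons_erase hb₀, Multiset.map_cons, Multiset.prod_cons]
        refine le_mul_of_one_le_right (inv_nonneg.mpr (norm_nonneg _)) (one_le_prod_map _ fun b hb => ?_)
        exact hge1 b (hmemP b (Multiset.mem_of_mem_erase hb)) _ hrt
      -- `‖F(b₀)‖ ≤ ‖y₀‖ θ^t`
      have hFb₀ : ‖aeval b₀ F‖ ≤ ‖y₀‖ * θ ^ t := by
        rw [hF, haeval]; exact norm_pow_mul_prime_pow_sub_one_le hd1.le t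
      have hFpos : 0 < ‖aeval b₀ F‖ := by
        rw [hF, haeval, norm_pos_iff, sub_ne_zero]; exact hne1 b₀ hb₀P _ hrt
      have hyθ : 0 < ‖y₀‖ * θ ^ t := hFpos.trans_le hFb₀
      -- compare with the bound
      have h1 : kerNorm Qp F * (‖y₀‖ * θ ^ t)⁻¹ ≤ C * kerNorm Qp F := by
        calc kerNorm Qp F * (‖y₀‖ * θ ^ t)⁻¹ ≤ kerNorm Qp F * ‖aeval b₀ F‖⁻¹ :=
              mul_le_mul_of_nonneg_left (inv_anti₀ hFpos hFb₀) (hQpos _ hrt).le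
          _ ≤ kerNorm Qp F * (u.map fun b => ‖aeval b F‖⁻¹).prod :=
              mul_le_mul_of_nonneg_left hu1 (hQpos _ hrt).le
          _ = kerNorm Pp F := hdec.symm
          _ ≤ C * kerNorm Qp F := hC _ hrt
      have h2 : (‖y₀‖ * θ ^ t)⁻¹ ≤ C := by
        have h3 : kerNorm Qp F * (‖y₀‖ * θ ^ t)⁻¹ ≤ kerNorm Qp F * C := by rw [mul_comm _ C]; exact h1
        exact le_of_mul_le_mul_left h3 (hQpos _ hrt)
      calc (1 : ℝ) = (‖y₀‖ * θ ^ t)⁻¹ * (‖y₀‖ * θ ^ t) := by rw [inv_mul_cancel₀ hyθ.ne']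
        _ ≤ C * (‖y₀‖ * θ ^ t) := mul_le_mul_of_nonneg_right h2 hyθ.le
    -- but `θ^t → 0`
    have hC0 : 0 < C * ‖y₀‖ := by
      have h := hkey 0
      rw [pow_zero, mul_one] at h
      exact one_pos.trans_le h
    obtain ⟨t, ht⟩ := exists_pow_lt_of_lt_one (inv_pos.mpr hC0) hθ1
    have h := hkey t
    rw [← mul_assoc] at h
    have : C * ‖y₀‖ * θ ^ t < 1 := by
      calc C * ‖y₀‖ * θ ^ t < C * ‖y₀‖ * (C * ‖y₀‖)⁻¹ := mul_lt_mul_of_pos_left ht hC0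
        _ = 1 := mul_inv_cancel₀ hC0.ne'
    exact absurd h (not_le.mpr this)
  -- hence all the extra factors are `1`
  intro r hr
  have hdec := kerNorm_eq_mul_of_roots_eq hu (X ^ r - 1 : ℤ[X])
  rw [← kerNorm] at hdec
  rw [hdec]
  have h1 : (u.map fun b => ‖aeval b (X ^ r - 1 : ℤ[X])‖⁻¹).prod = 1 := by
    refine Multiset.prod_eq_one fun x hx => ?_
    obtain ⟨b, hb, rfl⟩ := Multiset.mem_map.mp hx
    rw [haeval, norm_pow_sub_one_eq_one (hsmall b hb) hr, inv_one]
  rw [h1, mul_one]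

/-- **`|Res(P, X^r - 1)| = h_r` for all `r ≥ 1`** under the hypotheses of `natAbs_resultant_eq_mul_div` for every
`r ≥ 1` and a uniform bound `|Res(P, X^r - 1)| ≤ C · h_r` (which the archimedean side supplies). [folklore] -/
theorem natAbs_resultant_eq_of_bounded {P : ℤ[X]} (hP : P.Monic) {N : ℕ} (hPN : P.natDegree = N) (hN : 0 < N)
    {h : ℕ → ℕ} (hh : ∀ r, 0 < r → h r ≠ 0)
    (hℓ : ∀ (ℓ : ℕ) [Fact ℓ.Prime], ℓ ≠ p → ∀ r : ℕ, 0 < r →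
      ((ℓ : ℝ) ^ ((h r).factorization ℓ)) = kerNorm (P.map (Int.castRingHom ℤ_[ℓ])) (X ^ r - 1))
    {Qp : ℤ_[p][X]}
    (hle : (Qp.map (algebraMap ℤ_[p] (PadicAlgCl p))).roots ≤
      ((P.map (Int.castRingHom ℤ_[p])).map (algebraMap ℤ_[p] (PadicAlgCl p))).roots)
    (hpv : ∀ r : ℕ, 0 < r → ((p : ℝ) ^ ((h r).factorization p)) = kerNorm Qp (X ^ r - 1))
    {C : ℝ} (hC : ∀ r : ℕ, 0 < r → ((Polynomial.resultant P (X ^ r - 1) N r).natAbs : ℝ) ≤ C * h r) :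
    ∀ r : ℕ, 0 < r → (Polynomial.resultant P (X ^ r - 1) N r).natAbs = h r := by
  have hmain := fun r (hr : 0 < r) =>
    natAbs_resultant_eq_mul_div (p := p) hP hPN hr (hh r hr) (fun ℓ _ hne => hℓ ℓ hne r hr) hle (hpv r hr)
  have hR : ∀ r : ℕ, 0 < r → Polynomial.resultant P (X ^ r - 1) N r ≠ 0 := fun r hr => (hmain r hr).1
  -- the quotient is bounded by `C`
  have hCq : ∀ r : ℕ, 0 < r →
      kerNorm (P.map (Int.castRingHom ℤ_[p])) (X ^ r - 1) ≤ C * kerNorm Qp (X ^ r - 1) := by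
    intro r hr
    obtain ⟨-, hQpos, -, hid⟩ := hmain r hr
    have hh0 : (0 : ℝ) < h r := by exact_mod_cast Nat.pos_of_ne_zero (hh r hr)
    have h1 : (h r : ℝ) * (kerNorm (P.map (Int.castRingHom ℤ_[p])) (X ^ r - 1) / kerNorm Qp (X ^ r - 1)) ≤
        (h r : ℝ) * C := by rw [← hid, mul_comm]; exact hC r hr
    have h2 := le_of_mul_le_mul_left h1 hh0
    rwa [div_le_iff₀ hQpos] at h2
  have heq := kerNorm_eq_kerNorm_of_bounded hP hPN hN hR hle hCq
  intro r hr
  obtain ⟨-, hQpos, -, hid⟩ := hmain r hr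
  rw [heq r hr, div_self hQpos.ne', mul_one] at hid
  exact_mod_cast hid

end Main

end FrobeniusRigidity

end Literature.NumberTheory.LFunctions

end
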